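import Summits.ValiantsHypothesis.ValiantsHypothesis.Theorems.ProjectionStabilityOptStepStubTwoSidedTorusLower
import HarnessLib

/-!
# Two-sided-torus equivariant determinantal complexity of the permanent: `edc_{T²}(per_m) = 2^m − 1`

Corollary of stub K2 (`TwoSidedTorusLower.stub_twoSidedTorus_lower`, crux `ProjectionStability.OptStep`,
stmt-ValiantsHypothesis-17835, line `Sketch`) and Grenet's two-sided-torus-equivariant representation
(`Grenet.equivariantDetComplexity_perPoly_twoSidedTorus_le`, tree): for `m ≥ 3` the least size of an
affine determinantal representation of `per_m` over `ℂ` admitting exact lifts of all two-sided torus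
substitutions `X (i,j) ↦ d i * e j * X (i,j)` is exactly `2^m − 1`.

Landsberg–Ressayre 2017 prove `2^m − 1` for representations respecting the LEFT MONOMIAL group
`T ⋊ 𝔖_m` (Thm 2.8, tree `lr_left_equivariant_lower_holds`) and `C(2m,m) − 1` for the full symmetry
group (Thm 2.1); the torus-only statement here is not in LR17.  The hypothesis `m ≥ 3` is necessary:
`per_2 = det [[x₀₀, x₀₁], [−x₁₀, x₁₁]]` is two-sided-torus-equivariant of size `2 < 3` (and not regular).

## References
* J. M. Landsberg, N. Ressayre, arXiv:1508.05788, Thms 2.1, 2.8.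
* B. Grenet, An upper bound for the permanent versus determinant problem (2011).
-/

noncomputable section

set_option linter.dupNamespace false

namespace Summit.ValiantsHypothesis.ValiantsHypothesis.Theorems.ProjectionStabilityOptStep.TwoSidedTorusEdc

open Literature.Computability.AlgebraicComplexity
open Summit.ValiantsHypothesis.ValiantsHypothesis.Theorems.ProjectionStabilityOptStep

/-- **`edc_{T²}(per_m) = 2^m − 1` for `m ≥ 3`** (registered helper stub `stub_edc_twoSidedTorus_eq`
of stmt-ValiantsHypothesis-17835): the two-sided-torus equivariant determinantal complexity of the
permanent is Grenet's `2^m − 1`.  `≤`: Grenet's representation with its exact diagonal lifts (tree);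
`≥`: K2 applied to a representation attaining the infimum (the defining set is non-empty by Grenet).
[cite: LandsbergRessayre2017, Thm 2.8 (method)] -/
theorem stub_edc_twoSidedTorus_eq :
    ∀ m : ℕ, 3 ≤ m →
      equivariantDetComplexity
        (Subgroup.closure {γ : GL (Fin m × Fin m) ℂ | ∃ d e : Fin m → ℂ,
          (γ : Matrix (Fin m × Fin m) (Fin m × Fin m) ℂ) = Matrix.diagonal (fun p => d p.1 * e p.2)})
        (perPoly (Fin m) ℂ) = 2 ^ m - 1 := by
  intro m hm
  have hm0 : m ≠ 0 := by omega
  apply le_antisymm (Grenet.equivariantDetComplexity_perPoly_twoSidedTorus_le ℂ hm0)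
  have hex : ∃ n, HasEquivariantDetRepr
      (Subgroup.closure {γ : GL (Fin m × Fin m) ℂ | ∃ d e : Fin m → ℂ,
        (γ : Matrix (Fin m × Fin m) (Fin m × Fin m) ℂ) = Matrix.diagonal (fun p => d p.1 * e p.2)})
      (perPoly (Fin m) ℂ) n :=
    ⟨_, Grenet.hasEquivariantDetRepr_perPoly_twoSidedTorus ℂ hm0⟩
  obtain ⟨A, hA⟩ := Nat.sInf_mem hex
  exact TwoSidedTorusLower.stub_twoSidedTorus_lower m hm _ A hA

/-- The same in words closer to LR17: every two-sided-torus-equivariant affine determinantal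
representation of `per_m` (`m ≥ 3`) is at least as large as Grenet's, and Grenet's is one. [cite: LandsbergRessayre2017, Thm 2.8 (method)] -/
theorem le_size_of_twoSidedTorus_equivariant {m : ℕ} (hm : 3 ≤ m) {N : ℕ}
    {A : Matrix (Fin N) (Fin N) (MvPolynomial (Fin m × Fin m) ℂ)}
    (hA : IsEquivariantDetRepr
      (Subgroup.closure {γ : GL (Fin m × Fin m) ℂ | ∃ d e : Fin m → ℂ,
        (γ : Matrix (Fin m × Fin m) (Fin m × Fin m) ℂ) = Matrix.diagonal (fun p => d p.1 * e p.2)})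
      (perPoly (Fin m) ℂ) A) :
    equivariantDetComplexity
        (Subgroup.closure {γ : GL (Fin m × Fin m) ℂ | ∃ d e : Fin m → ℂ,
          (γ : Matrix (Fin m × Fin m) (Fin m × Fin m) ℂ) = Matrix.diagonal (fun p => d p.1 * e p.2)})
        (perPoly (Fin m) ℂ) ≤ N ∧ 2 ^ m - 1 ≤ N :=
  ⟨equivariantDetComplexity_le ⟨A, hA⟩, TwoSidedTorusLower.stub_twoSidedTorus_lower m hm N A hA⟩

end Summit.ValiantsHypothesis.ValiantsHypothesis.Theorems.ProjectionStabilityOptStep.TwoSidedTorusEdc
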